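import Mathlib.Analysis.Complex.TaylorSeries
import Mathlib.Analysis.Calculus.IteratedDeriv.Lemmas
import Mathlib.Analysis.Calculus.Deriv.Star
import Literature.NumberTheory.LFunctions.RiemannXi
import HarnessLib

/-!
# The Taylor expansion of `8 ξ(1/2 + z)` in the GORZ coefficients `γ(n)` — proved

Trunk T-NT-LFUNC (Literature/NumberTheory/LFunctions); cite item `wi-03709` (route
RiemannHypothesis/TotalPositivity assembly: `F(w) := Σ γ(n) wⁿ/n!` has `F(z²) = 8 ξ(1/2 + z)`).

Griffin–Ono–Rolen–Zagier 2019, eq. (1) DEFINE `γ(n)` by `(-1 + 4z²) Λ(1/2 + z) = Σₙ γ(n) z^{2n}/n!`;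
the tree's `Literature.xiTaylorCoeff n = Re(8 · n! · ξ⁽²ⁿ⁾(1/2)/(2n)!)` (`RiemannXi.lean`) is that
coefficient computed from `ξ(1/2 + z) = (4z² - 1) Λ(1/2 + z)/8`. Here we PROVE the generating
identity for the tree's objects,

  `hasSum_xiTaylorCoeff (h : riemannXi_conj) (z) :`
  `  HasSum (fun n => (xiTaylorCoeff n : ℂ) * z^(2n) / n!) (8 * riemannXi (1/2 + z))`,

from: (i) `ξ` is entire (`differentiable_riemannXi`), so its Taylor series at `1/2` converges
everywhere (Mathlib `Complex.hasSum_taylorSeries_of_entire`); (ii) `ξ(1 - s) = ξ(s)`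
(`riemannXi_one_sub`), so `z ↦ ξ(1/2 + z)` is even and its odd Taylor coefficients vanish
(`iteratedDeriv_comp_neg`); (iii) realness of `ξ⁽²ⁿ⁾(1/2)`, from the Schwarz reflection
`ξ(conj s) = conj ξ(s)` — the tree's named fact `Literature.NumberTheory.LFunctions.riemannXi_conj` (Titchmarsh §2.1), which is
therefore the only hypothesis (`iteratedDeriv` of a reflection-symmetric function is
reflection-symmetric, `deriv_conj_conj`). No factor to CHECK remains: with the tree's definition
the constant is exactly `8`.

## References

* M. Griffin, K. Ono, L. Rolen, D. Zagier, PNAS 116 (2019) 11103–11110, eq. (1).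
* E. C. Titchmarsh, *The Theory of the Riemann Zeta-Function*, 2nd ed. (1986), §2.1 (`ξ`), §10.1.
-/

noncomputable section

open Complex
open scoped Nat ComplexConjugate

namespace Literature.NumberTheory.LFunctions

/-- `z ↦ ξ(1/2 + z)` is even (functional equation). [Titchmarsh 1986, §2.1] [folklore] -/
theorem riemannXi_half_add_neg (z : ℂ) : riemannXi (1 / 2 + -z) = riemannXi (1 / 2 + z) := by
  rw [← riemannXi_one_sub (1 / 2 + z)]
  congr 1
  ring

/-- The odd Taylor coefficients of `ξ` at `1/2` vanish. [Titchmarsh 1986, §2.1; GORZ 2019, §1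
(only even powers in eq. (1))] [folklore] -/
theorem iteratedDeriv_riemannXi_half_odd (n : ℕ) :
    iteratedDeriv (2 * n + 1) riemannXi (1 / 2) = 0 := by
  set g : ℂ → ℂ := fun z => riemannXi (1 / 2 + z) with hg
  have heven : (fun z => g (-z)) = g := funext fun z => riemannXi_half_add_neg z
  have h1 := iteratedDeriv_comp_neg (2 * n + 1) g 0
  rw [heven, neg_zero, pow_succ, pow_mul, neg_one_sq, one_pow, one_mul, neg_one_smul] at h1
  have h0 : iteratedDeriv (2 * n + 1) g 0 = 0 := by
    have : (2 : ℂ) * iteratedDeriv (2 * n + 1) g 0 = 0 := by rw [two_mul]; nth_rw 2 [h1]; ring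
    simpa using this
  have hshift := congrFun (iteratedDeriv_comp_const_add (2 * n + 1) riemannXi (1 / 2)) 0
  rw [add_zero] at hshift
  rw [← hshift]
  exact h0

/-- Reflection symmetry passes to all derivatives: if `f (conj s) = conj (f s)` then the same holds
for `iteratedDeriv n f`. [Titchmarsh 1986, §2.1] [folklore] -/
theorem iteratedDeriv_conj_of_conj {f : ℂ → ℂ} (hf : ∀ s, f (conj s) = conj (f s)) (n : ℕ) (s : ℂ) :
    iteratedDeriv n f (conj s) = conj (iteratedDeriv n f s) := by
  induction n generalizing s with
  | zero => simpa using hf s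
  | succ n ih =>
    have hfun : (conj ∘ iteratedDeriv n f ∘ conj : ℂ → ℂ) = iteratedDeriv n f := by
      funext t
      simp only [Function.comp_apply, ih t, Complex.conj_conj]
    have key : deriv (iteratedDeriv n f) = conj ∘ deriv (iteratedDeriv n f) ∘ conj := by
      have := deriv_conj_conj (f := iteratedDeriv n f)
      rwa [hfun] at this
    rw [iteratedDeriv_succ]
    have := congrFun key (conj s)
    simpa [Complex.conj_conj] using this

/-- Under Schwarz reflection for `ξ` (tree fact `riemannXi_conj`) the Taylor coefficients of `ξ`
at `1/2` are real. [Titchmarsh 1986, §2.1] [folklore] -/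
theorem im_iteratedDeriv_riemannXi_half (h : riemannXi_conj) (n : ℕ) :
    (iteratedDeriv n riemannXi (1 / 2)).im = 0 := by
  have := iteratedDeriv_conj_of_conj h n (1 / 2)
  have hhalf : conj (1 / 2 : ℂ) = 1 / 2 := by
    rw [show (1 / 2 : ℂ) = ((1 / 2 : ℝ) : ℂ) by push_cast; ring, Complex.conj_ofReal]
  rw [hhalf] at this
  exact Complex.conj_eq_iff_im.1 this.symm

/-- Under `riemannXi_conj`, the GORZ coefficient as a complex number:
`(γ(n) : ℂ) = 8 · n! · ξ⁽²ⁿ⁾(1/2) / (2n)!`. [GORZ 2019, eq. (1)] [folklore] -/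
theorem ofReal_xiTaylorCoeff (h : riemannXi_conj) (n : ℕ) :
    (xiTaylorCoeff n : ℂ) = 8 * (n ! : ℂ) / ((2 * n)! : ℂ) * iteratedDeriv (2 * n) riemannXi (1 / 2) := by
  rw [xiTaylorCoeff]
  apply Complex.ext
  · simp
  · rw [Complex.ofReal_im]
    have hre : (8 * (n ! : ℂ) / ((2 * n)! : ℂ)) = (((8 * (n ! : ℝ) / ((2 * n)! : ℝ)) : ℝ) : ℂ) := by
      push_cast; ring
    rw [hre, Complex.im_ofReal_mul, im_iteratedDeriv_riemannXi_half h, mul_zero]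

/-- **The generating identity of the GORZ coefficients** (GORZ 2019, eq. (1) in the tree's
normalisation): for every `z ∈ ℂ`,
`Σₙ γ(n) z^{2n}/n! = 8 ξ(1/2 + z)` (`= (4z² - 1) Λ(1/2 + z)`), given the Schwarz reflection
`riemannXi_conj`. [Griffin–Ono–Rolen–Zagier 2019, eq. (1); Titchmarsh 1986, §2.1] [folklore] -/
theorem hasSum_xiTaylorCoeff (h : riemannXi_conj) (z : ℂ) :
    HasSum (fun n : ℕ => (xiTaylorCoeff n : ℂ) * z ^ (2 * n) / (n ! : ℂ))
      (8 * riemannXi (1 / 2 + z)) := by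
  -- Taylor series of the entire function `ξ` at `1/2`, evaluated at `1/2 + z`
  have hT := Complex.hasSum_taylorSeries_of_entire differentiable_riemannXi (1 / 2) (1 / 2 + z)
  simp only [add_sub_cancel_left, smul_eq_mul] at hT
  -- pass to even indices: odd terms vanish
  set f : ℕ → ℂ := fun n => (n ! : ℂ)⁻¹ * (z ^ n * iteratedDeriv n riemannXi (1 / 2)) with hf
  have hodd : ∀ m, m ∉ Set.range (fun n : ℕ => 2 * n) → f m = 0 := by
    intro m hm
    obtain ⟨n, rfl | rfl⟩ := Nat.even_or_odd' m
    · exact absurd ⟨n, rfl⟩ hm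
    · simp only [hf]
      rw [iteratedDeriv_riemannXi_half_odd n]
      simp
  have hinj : Function.Injective fun n : ℕ => 2 * n := fun a b hab => by simpa using hab
  have hE : HasSum (f ∘ fun n : ℕ => 2 * n) (riemannXi (1 / 2 + z)) :=
    (hinj.hasSum_iff hodd).2 hT
  -- multiply by 8 and identify the terms
  have h8 := hE.mul_left 8
  have hfun : (fun n : ℕ => (xiTaylorCoeff n : ℂ) * z ^ (2 * n) / (n ! : ℂ)) =
      fun n => 8 * (f ∘ fun n : ℕ => 2 * n) n := by
    funext n
    simp only [Function.comp_apply, hf, ofReal_xiTaylorCoeff h n]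
    have hn : (n ! : ℂ) ≠ 0 := by exact_mod_cast Nat.factorial_ne_zero n
    have h2n : ((2 * n)! : ℂ) ≠ 0 := by exact_mod_cast Nat.factorial_ne_zero (2 * n)
    field_simp
  rw [hfun]
  exact h8

end Literature.NumberTheory.LFunctions
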